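import Literature.Topology.FourManifolds.GaussDiagramsStability
import HarnessLib

/-!
# Stability of regular readings relative to a window (locality of the events)

Companion of `GaussDiagramsStability.lean`, towards the named fact
`Literature.Topology.FourManifolds.Knot.reidemeisterR` (analysis of the elementary events of the
direction `→`). At a non-regular time of a generic isotopy of knot projections, the reading fails
to be regular only near finitely many parameters — the *window* `W` (a `2π`-periodic open set of
parameters: small intervals around the two parameters of a self-tangency, or the three parameters
of a triple point). This file proves that **everything away from the window is stable**: if at
`t = 0` the pair `(Γ 0, H 0)` (plane curve, heights) has a *reading off `W`*
(`IsRegularReadingOff W`: the axioms of a regular reading — strictly increasing parameters in one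
period, outside the closure of `W`, immersion, the listed chords are transverse double points with
the over-passage higher and the recorded signs — except that double points with BOTH parameters
in `W` are not constrained), then for all `t` near `0` the pair `(Γ t, H t)` has a reading off `W`
with the same diagram (`IsRegularReadingOff.eventually_exists`). Thus along an `Ω2` or `Ω3` event
the chords away from the event persist with their order, heights and signs, and no double point is
created with a parameter outside the window: the Gauss diagram changes only by what happens
inside `W`. (The first move `Ω1` is not covered: there the curve fails to be immersed inside the
window.) The proof is that of `IsRegularReading.eventually_exists` (loc. cit.), with the pairs of
parameters in `W × W` removed from the compact set of far pairs.

## References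

* V. Guillemin, A. Pollack, *Differential Topology*, AMS Chelsea (2010), Ch. 1 §6 (stability).
  [GuilleminPollack2010]
* K. Reidemeister, *Knotentheorie*, Springer (1932), Kap. I §1 (the moves as the elementary
  changes of a projection). [Reidemeister1932]
-/

open Function Set Filter Metric Topology
open scoped Real

noncomputable section

namespace Literature.Topology.FourManifolds

/-! ### Readings off a window -/

/-- A **reading off the window `W`** with Gauss diagram `G` and parameters `θ` of a plane curve
`γ` with heights `h`: the axioms of `IsRegularReading γ h G θ` (strictly increasing parameters in
one period, immersion, the chords of `G` are double points with the over-passage higher and the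
recorded signs), the parameters lying outside the closure of `W`, and the chords being the only
double points modulo `2π` EXCEPT possibly double points with both parameters in `W`.
Reidemeister (1932), Kap. I §1. [folklore] -/
structure IsRegularReadingOff (W : Set ℝ) (γ : ℝ → ℝ × ℝ) (h : ℝ → ℝ) (G : GaussDiagram)
    (θ : Fin (2 * G.n) → ℝ) : Prop where
  /-- The parameters increase with the position. -/
  strictMono : StrictMono θ
  /-- All parameters lie in one period. -/
  lt_add_two_pi : ∀ i j, θ i < θ j + 2 * Real.pi
  /-- The parameters lie outside the closure of the window. -/
  not_mem_closure : ∀ q, θ q ∉ closure W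
  /-- The plane curve is an immersion. -/
  deriv_ne_zero : ∀ t, deriv γ t ≠ 0
  /-- The two passages of a chord project to the same point. -/
  double : ∀ i, γ (θ (G.overPos i)) = γ (θ (G.underPos i))
  /-- The chords are the only double points modulo the period, except inside the window. -/
  eq_or_crossing_or_mem : ∀ s t, γ s = γ t → (∃ k : ℤ, t = s + k * (2 * Real.pi)) ∨
    (∃ (i : Fin G.n) (k l : ℤ), ({s + k * (2 * Real.pi), t + l * (2 * Real.pi)} : Set ℝ)
      = {θ (G.overPos i), θ (G.underPos i)}) ∨ (s ∈ W ∧ t ∈ W)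
  /-- The over-passage is the higher one. -/
  height_lt : ∀ i, h (θ (G.underPos i)) < h (θ (G.overPos i))
  /-- The sign of a chord is the sign of `det (γ' over, γ' under)`. -/
  sign_eq : ∀ i, (G.sign i : ℤ) = SignType.sign (Matrix.det
    !![(deriv γ (θ (G.overPos i))).1, (deriv γ (θ (G.overPos i))).2;
       (deriv γ (θ (G.underPos i))).1, (deriv γ (θ (G.underPos i))).2])

/-- A regular reading whose parameters avoid the closure of `W` is a reading off `W`.
[folklore] -/
theorem IsRegularReading.off {W : Set ℝ} {γ : ℝ → ℝ × ℝ} {h : ℝ → ℝ} {G : GaussDiagram}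
    {θ : Fin (2 * G.n) → ℝ} (hr : IsRegularReading γ h G θ) (hW : ∀ q, θ q ∉ closure W) :
    IsRegularReadingOff W γ h G θ :=
  ⟨hr.strictMono, hr.lt_add_two_pi, hW, hr.deriv_ne_zero, hr.double,
    fun s t hst ↦ (hr.eq_or_crossing s t hst).imp_right Or.inl, hr.height_lt, hr.sign_eq⟩

/-- A reading off the empty window is a regular reading. [folklore] -/
theorem IsRegularReadingOff.isRegularReading_of_empty {γ : ℝ → ℝ × ℝ} {h : ℝ → ℝ}
    {G : GaussDiagram} {θ : Fin (2 * G.n) → ℝ} (hr : IsRegularReadingOff ∅ γ h G θ) :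
    IsRegularReading γ h G θ :=
  ⟨hr.strictMono, hr.lt_add_two_pi, hr.deriv_ne_zero, hr.double, fun s t hst ↦ by
    rcases hr.eq_or_crossing_or_mem s t hst with h1 | h2 | ⟨h3, -⟩
    · exact Or.inl h1
    · exact Or.inr h2
    · exact h3.elim, hr.height_lt, hr.sign_eq⟩

/-- A reading off `W` without double points inside the window is a regular reading.
[folklore] -/
theorem IsRegularReadingOff.isRegularReading {W : Set ℝ} {γ : ℝ → ℝ × ℝ} {h : ℝ → ℝ}
    {G : GaussDiagram} {θ : Fin (2 * G.n) → ℝ} (hr : IsRegularReadingOff W γ h G θ)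
    (hW : ∀ s t, s ∈ W → t ∈ W → γ s = γ t → ∃ k : ℤ, t = s + k * (2 * Real.pi)) :
    IsRegularReading γ h G θ :=
  ⟨hr.strictMono, hr.lt_add_two_pi, hr.deriv_ne_zero, hr.double, fun s t hst ↦ by
    rcases hr.eq_or_crossing_or_mem s t hst with h1 | h2 | ⟨hs, ht⟩
    · exact Or.inl h1
    · exact Or.inr h2
    · exact Or.inl (hW s t hs ht hst), hr.height_lt, hr.sign_eq⟩

namespace IsRegularReadingOff

/-- The determinant of a chord of a reading off a window is non-zero. [folklore] -/
theorem det_ne_zero {W : Set ℝ} {γ : ℝ → ℝ × ℝ} {h : ℝ → ℝ} {G : GaussDiagram}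
    {θ : Fin (2 * G.n) → ℝ} (hr : IsRegularReadingOff W γ h G θ) (i : Fin G.n) :
    (deriv γ (θ (G.overPos i))).1 * (deriv γ (θ (G.underPos i))).2 -
      (deriv γ (θ (G.overPos i))).2 * (deriv γ (θ (G.underPos i))).1 ≠ 0 := by
  intro h0
  have := hr.sign_eq i
  rw [Matrix.det_fin_two_of, h0, sign_zero] at this
  exact (G.sign i).ne_zero (by exact_mod_cast this)

/-- **Readings off a window persist in `C¹` families, with the same diagram** (locality of the
events). Let `W` be an open, `2π`-periodic set of parameters, `Γ : ℝ → ℝ → ℝ × ℝ` jointly `C¹` with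
every `Γ t` `2π`-periodic, `H : ℝ → ℝ → ℝ` jointly continuous, and let `(Γ 0, H 0)` have a reading
off `W` with Gauss diagram `G`. Then for all `t` near `0` the pair `(Γ t, H t)` has a reading off
`W` with the same diagram `G`: the chords away from the window persist with their order, heights
and signs, and every double point of `Γ t` with a parameter outside `W` (modulo `2π`) is one of
them. Guillemin–Pollack (1974), Ch. 1 §6 (stability); Reidemeister (1932), Kap. I §1.
[cite: GuilleminPollack2010, Ch. 1 §6] -/
theorem eventually_exists {W : Set ℝ} (hWo : IsOpen W)
    (hWper : ∀ s, s + 2 * Real.pi ∈ W ↔ s ∈ W) {Γ : ℝ → ℝ → ℝ × ℝ} {H : ℝ → ℝ → ℝ}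
    (hΓ : ContDiff ℝ 1 (uncurry Γ)) (hH : Continuous (uncurry H))
    (hper : ∀ t, Periodic (Γ t) (2 * Real.pi)) {G : GaussDiagram} {θ₀ : Fin (2 * G.n) → ℝ}
    (h₀ : IsRegularReadingOff W (Γ 0) (H 0) G θ₀) :
    ∀ᶠ t in 𝓝 (0 : ℝ), ∃ θ : Fin (2 * G.n) → ℝ, IsRegularReadingOff W (Γ t) (H t) G θ := by
  -- membership in the periodic window is invariant under the period lattice
  have hWk : ∀ (x : ℝ) (k : ℤ), x + k * (2 * Real.pi) ∈ W ↔ x ∈ W := by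
    intro x k
    induction k using Int.induction_on generalizing x with
    | zero => simp
    | succ n ih =>
      have e : x + ((n : ℤ) + 1 : ℤ) * (2 * Real.pi) = x + (n : ℤ) * (2 * Real.pi) + 2 * Real.pi := by
        push_cast; ring
      rw [e, hWper]
      exact ih x
    | pred n ih =>
      have e : x + (-(n : ℤ) - 1 : ℤ) * (2 * Real.pi) + 2 * Real.pi
          = x + (-(n : ℤ) : ℤ) * (2 * Real.pi) := by
        push_cast; ring
      rw [← hWper, e]
      exact ih x
  have hπ : 0 < 2 * Real.pi := Real.two_pi_pos
  have h10 : (1 : WithTop ℕ∞) ≠ 0 := one_ne_zero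
  -- the members of the family and their velocities
  have hγ : ∀ t, ContDiff ℝ 1 (Γ t) := fun t ↦
    hΓ.comp (contDiff_const.prodMk contDiff_id)
  have hd : ∀ t θ, DifferentiableAt ℝ (Γ t) θ := fun t θ ↦ ((hγ t).differentiable h10) θ
  set D : ℝ × ℝ → ℝ × ℝ := fun p ↦ fderiv ℝ (uncurry Γ) p (0, 1) with hD_def
  have hD : Continuous D := (hΓ.continuous_fderiv h10).clm_apply continuous_const
  have hDeq : ∀ t θ, deriv (Γ t) θ = D (t, θ) := fun t θ ↦
    DoublePointPersistence.deriv_eq_fderiv_uncurry hΓ h10 t θ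
  have hDper : ∀ t, Periodic (fun θ ↦ D (t, θ)) (2 * Real.pi) := fun t θ ↦ by
    simp only [← hDeq]
    exact periodic_deriv_of_periodic (hper t) θ
  -- local injectivity modulus and speed bound of `Γ 0`
  obtain ⟨m, hm, δ₁, hδ₁, hmle, hmod⟩ := exists_local_modulus (hγ 0) (hper 0) h₀.deriv_ne_zero
  -- (1) velocities uniformly close: immersion and local modulus persist
  have hE1 : ∀ᶠ t in 𝓝 (0 : ℝ), ∀ θ, ‖D (t, θ) - D (0, θ)‖ < m / 2 :=
    eventually_forall_norm_sub_lt_of_periodic hD hDper 0 (half_pos hm)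
  have hreg : ∀ᶠ t in 𝓝 (0 : ℝ), ∀ θ, deriv (Γ t) θ ≠ 0 := by
    filter_upwards [hE1] with t ht θ h0
    have h1 := ht θ
    rw [← hDeq, ← hDeq, h0, zero_sub, norm_neg] at h1
    linarith [hmle θ]
  have hloc : ∀ᶠ t in 𝓝 (0 : ℝ), ∀ s u, |s - u| ≤ δ₁ → m / 2 * |s - u| ≤ ‖Γ t s - Γ t u‖ := by
    filter_upwards [hE1] with t ht s u hsu
    have hdf : ∀ x ∈ (univ : Set ℝ), DifferentiableAt ℝ (Γ t - Γ 0) x :=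
      fun x _ ↦ (hd t x).sub (hd 0 x)
    have hbd : ∀ x ∈ (univ : Set ℝ), ‖deriv (Γ t - Γ 0) x‖ ≤ m / 2 := fun x _ ↦ by
      rw [deriv_sub (hd t x) (hd 0 x), hDeq, hDeq]
      exact (ht x).le
    have hmv := Convex.norm_image_sub_le_of_norm_deriv_le hdf hbd convex_univ (mem_univ u)
      (mem_univ s)
    simp only [Pi.sub_apply] at hmv
    rw [Real.norm_eq_abs] at hmv
    have h2 := hmod s u hsu
    have h3 : ‖Γ 0 s - Γ 0 u‖ ≤ ‖Γ t s - Γ t u‖ + ‖(Γ t s - Γ 0 s) - (Γ t u - Γ 0 u)‖ := by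
      rw [show Γ 0 s - Γ 0 u = (Γ t s - Γ t u) - ((Γ t s - Γ 0 s) - (Γ t u - Γ 0 u)) by abel]
      exact norm_sub_le _ _
    linarith
  -- (2) the crossings are tracked
  have htr : ∀ i : Fin G.n, ∃ (δ : ℝ) (σ υ : ℝ → ℝ), 0 < δ ∧ ContinuousOn σ (Ioo (0 - δ) (0 + δ)) ∧
      ContinuousOn υ (Ioo (0 - δ) (0 + δ)) ∧ σ 0 = θ₀ (G.overPos i) ∧ υ 0 = θ₀ (G.underPos i) ∧
      (∀ t, |t - 0| < δ → Γ t (σ t) = Γ t (υ t)) ∧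
      ∀ t s u, |t - 0| < δ → |s - θ₀ (G.overPos i)| < δ → |u - θ₀ (G.underPos i)| < δ →
        Γ t s = Γ t u → s = σ t ∧ u = υ t := fun i ↦
    exists_doublePoint_track hΓ h10 (h₀.double i) (h₀.det_ne_zero i)
  choose δc σ υ hδc hσc hυc hσ0 hυ0 htrack huniq using htr
  have hσa : ∀ i, ContinuousAt (σ i) 0 := fun i ↦
    (hσc i).continuousAt (Ioo_mem_nhds (by linarith [hδc i]) (by linarith [hδc i]))
  have hυa : ∀ i, ContinuousAt (υ i) 0 := fun i ↦
    (hυc i).continuousAt (Ioo_mem_nhds (by linarith [hδc i]) (by linarith [hδc i]))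
  -- the parameters at time `t`
  set Θ : ℝ → Fin (2 * G.n) → ℝ := fun t ↦ G.trackθ (fun i ↦ σ i t) (fun i ↦ υ i t) with hΘ_def
  have hΘ0 : Θ 0 = θ₀ := by
    have : (fun i ↦ σ i 0) = (fun i ↦ θ₀ (G.overPos i)) := funext hσ0
    have h' : (fun i ↦ υ i 0) = (fun i ↦ θ₀ (G.underPos i)) := funext hυ0
    simp only [hΘ_def, this, h', G.trackθ_eq]
  have hΘa : ∀ q, ContinuousAt (fun t ↦ Θ t q) 0 := by
    intro q
    obtain ⟨i, rfl | rfl⟩ := G.exists_eq_overPos_or_underPos q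
    · simp only [hΘ_def, GaussDiagram.trackθ_overPos]; exact hσa i
    · simp only [hΘ_def, GaussDiagram.trackθ_underPos]; exact hυa i
  have hΘt : ∀ q, Tendsto (fun t ↦ Θ t q) (𝓝 0) (𝓝 (θ₀ q)) := fun q ↦ by
    have := (hΘa q).tendsto
    rwa [hΘ0] at this
  -- (3) order, window, heights, signs persist
  have hmono : ∀ᶠ t in 𝓝 (0 : ℝ), ∀ q q' : Fin (2 * G.n), q < q' → Θ t q < Θ t q' := by
    refine eventually_all.2 fun q ↦ eventually_all.2 fun q' ↦ ?_
    by_cases hqq : q < q'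
    · filter_upwards [(hΘt q).eventually_lt (hΘt q') (h₀.strictMono hqq)] with t ht _
      exact ht
    · exact Eventually.of_forall fun t h ↦ absurd h hqq
  have hwin : ∀ᶠ t in 𝓝 (0 : ℝ), ∀ q q' : Fin (2 * G.n), Θ t q < Θ t q' + 2 * Real.pi := by
    refine eventually_all.2 fun q ↦ eventually_all.2 fun q' ↦ ?_
    exact (hΘt q).eventually_lt ((hΘt q').add_const _) (h₀.lt_add_two_pi q q')
  have hheight : ∀ᶠ t in 𝓝 (0 : ℝ), ∀ i, H t (υ i t) < H t (σ i t) := by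
    refine eventually_all.2 fun i ↦ ?_
    have h1 : Tendsto (fun t ↦ H t (υ i t)) (𝓝 0) (𝓝 (H 0 (θ₀ (G.underPos i)))) := by
      have := (hH.continuousAt (x := (0, υ i 0))).tendsto.comp
        ((continuousAt_id.prodMk (hυa i)).tendsto)
      simpa [hυ0 i, Function.comp_def] using this
    have h2 : Tendsto (fun t ↦ H t (σ i t)) (𝓝 0) (𝓝 (H 0 (θ₀ (G.overPos i)))) := by
      have := (hH.continuousAt (x := (0, σ i 0))).tendsto.comp
        ((continuousAt_id.prodMk (hσa i)).tendsto)
      simpa [hσ0 i, Function.comp_def] using this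
    exact h1.eventually_lt h2 (h₀.height_lt i)
  have hsign : ∀ᶠ t in 𝓝 (0 : ℝ), ∀ i, SignType.sign ((D (t, σ i t)).1 * (D (t, υ i t)).2 -
      (D (t, σ i t)).2 * (D (t, υ i t)).1) = SignType.sign ((D (0, θ₀ (G.overPos i))).1 *
        (D (0, θ₀ (G.underPos i))).2 - (D (0, θ₀ (G.overPos i))).2 * (D (0, θ₀ (G.underPos i))).1) := by
    refine eventually_all.2 fun i ↦ eventually_sign_eq ?_ ?_
    · have hDσ : Tendsto (fun t ↦ D (t, σ i t)) (𝓝 0) (𝓝 (D (0, θ₀ (G.overPos i)))) := by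
        have := (hD.continuousAt (x := (0, σ i 0))).tendsto.comp
          ((continuousAt_id.prodMk (hσa i)).tendsto)
        simpa [hσ0 i, Function.comp_def] using this
      have hDυ : Tendsto (fun t ↦ D (t, υ i t)) (𝓝 0) (𝓝 (D (0, θ₀ (G.underPos i)))) := by
        have := (hD.continuousAt (x := (0, υ i 0))).tendsto.comp
          ((continuousAt_id.prodMk (hυa i)).tendsto)
        simpa [hυ0 i, Function.comp_def] using this
      exact ((continuous_fst.tendsto _ |>.comp hDσ).mul (continuous_snd.tendsto _ |>.comp hDυ)).sub
        ((continuous_snd.tendsto _ |>.comp hDσ).mul (continuous_fst.tendsto _ |>.comp hDυ))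
    · have := h₀.det_ne_zero i
      rwa [hDeq, hDeq] at this
  have htime : ∀ᶠ t in 𝓝 (0 : ℝ), ∀ i, |t - 0| < δc i := by
    refine eventually_all.2 fun i ↦ ?_
    filter_upwards [Metric.ball_mem_nhds (0 : ℝ) (hδc i)] with t ht
    rwa [Metric.mem_ball, Real.dist_eq] at ht
  have hout : ∀ᶠ t in 𝓝 (0 : ℝ), ∀ q, Θ t q ∉ closure W := by
    refine eventually_all.2 fun q ↦ ?_
    exact (hΘt q).eventually (isClosed_closure.isOpen_compl.mem_nhds (h₀.not_mem_closure q))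
  -- (4) far pairs of parameters stay separated (off the window)
  obtain ⟨w, ε₀, hε₀, hwq⟩ := exists_window h₀.strictMono h₀.lt_add_two_pi
  set Q : Set (ℝ × ℝ) := Icc w (w + 2 * Real.pi) ×ˢ Icc w (w + 2 * Real.pi) with hQ_def
  set N₁ : Set (ℝ × ℝ) := {p | |p.1 - p.2| < δ₁} ∪ {p | |p.1 - p.2 - 2 * Real.pi| < δ₁} ∪
    {p | |p.1 - p.2 + 2 * Real.pi| < δ₁} with hN₁_def
  set N₂ : Set (ℝ × ℝ) := ⋃ i : Fin G.n,
    ({p | |p.1 - θ₀ (G.overPos i)| < δc i ∧ |p.2 - θ₀ (G.underPos i)| < δc i} ∪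
      {p | |p.1 - θ₀ (G.underPos i)| < δc i ∧ |p.2 - θ₀ (G.overPos i)| < δc i}) with hN₂_def
  have hN₁o : IsOpen N₁ :=
    ((isOpen_lt (continuous_fst.sub continuous_snd).abs continuous_const).union
      (isOpen_lt ((continuous_fst.sub continuous_snd).sub continuous_const).abs
        continuous_const)).union
      (isOpen_lt ((continuous_fst.sub continuous_snd).add continuous_const).abs continuous_const)
  have hN₂o : IsOpen N₂ := by
    refine isOpen_iUnion fun i ↦ IsOpen.union ?_ ?_
    · exact (isOpen_lt (continuous_fst.sub continuous_const).abs continuous_const).inter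
        (isOpen_lt (continuous_snd.sub continuous_const).abs continuous_const)
    · exact (isOpen_lt (continuous_fst.sub continuous_const).abs continuous_const).inter
        (isOpen_lt (continuous_snd.sub continuous_const).abs continuous_const)
  set N₃ : Set (ℝ × ℝ) := {p | p.1 ∈ W ∧ p.2 ∈ W} with hN₃_def
  have hN₃o : IsOpen N₃ := (hWo.preimage continuous_fst).inter (hWo.preimage continuous_snd)
  set C : Set (ℝ × ℝ) := Q \ ((N₁ ∪ N₂) ∪ N₃) with hC_def
  have hCc : IsCompact C := (isCompact_Icc.prod isCompact_Icc).diff ((hN₁o.union hN₂o).union hN₃o)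
  -- `Γ 0` has no double point on `C`
  have hCpos : ∀ p ∈ C, Γ 0 p.1 ≠ Γ 0 p.2 := by
    rintro ⟨s, u⟩ ⟨⟨hs, hu⟩, hN⟩ hsu
    simp only [mem_Icc] at hs hu
    apply hN
    rcases h₀.eq_or_crossing_or_mem s u hsu with ⟨k, hk⟩ | ⟨i, k, l, hset⟩ | ⟨hsW, huW⟩
    · -- congruent parameters in one period square: the diagonal or its corner translates
      left; left
      have hk1 : (k : ℝ) < 2 := by
        by_contra hc; push Not at hc
        nlinarith [hs.1, hs.2, hu.1, hu.2]
      have hk2 : (-2 : ℝ) < k := by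
        by_contra hc; push Not at hc
        nlinarith [hs.1, hs.2, hu.1, hu.2]
      have hk3 : k = -1 ∨ k = 0 ∨ k = 1 := by
        have h1 : (k : ℤ) < 2 := by exact_mod_cast hk1
        have h2 : (-2 : ℤ) < k := by exact_mod_cast hk2
        omega
      simp only [hN₁_def, mem_union, mem_setOf_eq]
      rcases hk3 with rfl | rfl | rfl
      · left; right; push_cast at hk; rw [show s - u - 2 * Real.pi = 0 by linarith, abs_zero]
        exact hδ₁
      · left; left; push_cast at hk; rw [show s - u = 0 by linarith, abs_zero]; exact hδ₁
      · right; push_cast at hk; rw [show s - u + 2 * Real.pi = 0 by linarith, abs_zero]; exact hδ₁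
    · -- a crossing pair of `Γ 0`: both lifts are in the margin window, so `k = l = 0`
      left; right
      have hmem_s : s + k * (2 * Real.pi) ∈ ({θ₀ (G.overPos i), θ₀ (G.underPos i)} : Set ℝ) := by
        rw [← hset]; exact mem_insert _ _
      have hmem_u : u + l * (2 * Real.pi) ∈ ({θ₀ (G.overPos i), θ₀ (G.underPos i)} : Set ℝ) := by
        rw [← hset]; exact mem_insert_of_mem _ (mem_singleton _)
      have hwin_s : s + k * (2 * Real.pi) ∈ Icc (w + ε₀) (w + 2 * Real.pi - ε₀) := by
        rcases hmem_s with h | h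
        · rw [h]; exact hwq _
        · rw [mem_singleton_iff.1 h]; exact hwq _
      have hwin_u : u + l * (2 * Real.pi) ∈ Icc (w + ε₀) (w + 2 * Real.pi - ε₀) := by
        rcases hmem_u with h | h
        · rw [h]; exact hwq _
        · rw [mem_singleton_iff.1 h]; exact hwq _
      have hk0 : k = 0 := by
        have h1 : (k : ℝ) < 1 := by
          by_contra hc; push Not at hc; nlinarith [hs.1, hs.2, hwin_s.1, hwin_s.2]
        have h2 : (-1 : ℝ) < k := by
          by_contra hc; push Not at hc; nlinarith [hs.1, hs.2, hwin_s.1, hwin_s.2]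
        have h1' : (k : ℤ) < 1 := by exact_mod_cast h1
        have h2' : (-1 : ℤ) < k := by exact_mod_cast h2
        omega
      have hl0 : l = 0 := by
        have h1 : (l : ℝ) < 1 := by
          by_contra hc; push Not at hc; nlinarith [hu.1, hu.2, hwin_u.1, hwin_u.2]
        have h2 : (-1 : ℝ) < l := by
          by_contra hc; push Not at hc; nlinarith [hu.1, hu.2, hwin_u.1, hwin_u.2]
        have h1' : (l : ℤ) < 1 := by exact_mod_cast h1
        have h2' : (-1 : ℤ) < l := by exact_mod_cast h2
        omega
      subst hk0; subst hl0
      simp only [Int.cast_zero, zero_mul, add_zero] at hset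
      simp only [hN₂_def, mem_iUnion, mem_union, mem_setOf_eq]
      refine ⟨i, ?_⟩
      rcases Set.pair_eq_pair_iff.1 hset with ⟨h1, h2⟩ | ⟨h1, h2⟩
      · left; rw [h1, h2, sub_self, sub_self, abs_zero]; exact ⟨hδc i, hδc i⟩
      · right; rw [h1, h2, sub_self, sub_self, abs_zero]; exact ⟨hδc i, hδc i⟩
    · -- both parameters in the window
      right
      exact ⟨hsW, huW⟩
  -- hence a positive separation on `C`, and `Γ t` has no double point on `C` for `t` small
  have hβ : ∃ β > 0, ∀ p ∈ C, β ≤ ‖Γ 0 p.1 - Γ 0 p.2‖ := by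
    rcases C.eq_empty_or_nonempty with hCe | hCn
    · exact ⟨1, one_pos, fun p hp ↦ by rw [hCe] at hp; exact hp.elim⟩
    · have hcont : Continuous fun p : ℝ × ℝ ↦ ‖Γ 0 p.1 - Γ 0 p.2‖ :=
        (((hγ 0).continuous.comp continuous_fst).sub ((hγ 0).continuous.comp continuous_snd)).norm
      obtain ⟨p₀, hp₀, hmin⟩ := hCc.exists_isMinOn hCn hcont.continuousOn
      refine ⟨‖Γ 0 p₀.1 - Γ 0 p₀.2‖, norm_pos_iff.2 (sub_ne_zero.2 (hCpos p₀ hp₀)), fun p hp ↦ ?_⟩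
      exact hmin hp
  obtain ⟨β, hβ, hβle⟩ := hβ
  have hE0 : ∀ᶠ t in 𝓝 (0 : ℝ), ∀ θ, ‖Γ t θ - Γ 0 θ‖ < β / 2 :=
    eventually_forall_norm_sub_lt_of_periodic (F := uncurry Γ) hΓ.continuous hper 0 (half_pos hβ)
  have hfar : ∀ᶠ t in 𝓝 (0 : ℝ), ∀ p ∈ C, Γ t p.1 ≠ Γ t p.2 := by
    filter_upwards [hE0] with t ht p hp heq
    have h1 := hβle p hp
    have h2 := ht p.1
    have h3 := ht p.2
    have h4 : ‖Γ 0 p.1 - Γ 0 p.2‖ ≤ ‖Γ t p.1 - Γ 0 p.1‖ + ‖Γ t p.2 - Γ 0 p.2‖ := by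
      rw [show Γ 0 p.1 - Γ 0 p.2 = (Γ t p.2 - Γ 0 p.2) - (Γ t p.1 - Γ 0 p.1) by rw [heq]; abel]
      exact (norm_sub_le _ _).trans (by linarith)
    change ‖Γ t p.1 - Γ 0 p.1‖ < β / 2 at h2
    change ‖Γ t p.2 - Γ 0 p.2‖ < β / 2 at h3
    linarith
  -- (5) assembling the reading at time `t`
  filter_upwards [hreg, hloc, hmono, hwin, hheight, hsign, htime, hfar, hout] with t ht_reg ht_loc
    ht_mono ht_win ht_height ht_sign ht_time ht_far ht_out
  refine ⟨Θ t, ⟨fun q q' h ↦ ht_mono q q' h, ht_win, ht_out, ht_reg, fun i ↦ ?_,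
    fun s u hsu ↦ ?_, fun i ↦ ?_, fun i ↦ ?_⟩⟩
  · -- double
    simp only [hΘ_def, GaussDiagram.trackθ_overPos, GaussDiagram.trackθ_underPos]
    exact htrack i t (ht_time i)
  · -- eq_or_crossing: reduce both parameters into the period window `[w, w + 2π)`
    obtain ⟨k, hk⟩ := exists_int_sub_mul_two_pi_mem_Ico (s - w)
    obtain ⟨l, hl⟩ := exists_int_sub_mul_two_pi_mem_Ico (u - w)
    set s' := s - k * (2 * Real.pi) with hs'_def
    set u' := u - l * (2 * Real.pi) with hu'_def
    have hs' : s' ∈ Ico w (w + 2 * Real.pi) := by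
      simp only [mem_Ico] at hk ⊢; constructor <;> linarith [hk.1, hk.2]
    have hu' : u' ∈ Ico w (w + 2 * Real.pi) := by
      simp only [mem_Ico] at hl ⊢; constructor <;> linarith [hl.1, hl.2]
    have hsu' : Γ t s' = Γ t u' := by
      rw [hs'_def, hu'_def, (hper t).sub_int_mul_eq k, (hper t).sub_int_mul_eq l, hsu]
    have hpQ : ((s', u') : ℝ × ℝ) ∈ Q := ⟨Ico_subset_Icc_self hs', Ico_subset_Icc_self hu'⟩
    have hpN : ((s', u') : ℝ × ℝ) ∈ (N₁ ∪ N₂) ∪ N₃ := by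
      by_contra hcon
      exact ht_far (s', u') ⟨hpQ, hcon⟩ hsu'
    rcases hpN with (hp1 | hp2) | hp3
    · -- nearby parameters: equal by the local modulus, so `s ≡ u`
      left
      simp only [hN₁_def, mem_union, mem_setOf_eq] at hp1
      rcases hp1 with (h1 | h1) | h1
      · have h2 := ht_loc s' u' h1.le
        rw [hsu', sub_self, norm_zero] at h2
        have h3 : |s' - u'| = 0 := by nlinarith [abs_nonneg (s' - u')]
        rw [abs_eq_zero, sub_eq_zero] at h3
        refine ⟨l - k, ?_⟩
        rw [hs'_def, hu'_def] at h3
        push_cast; linarith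
      · have h2 := ht_loc s' (u' + 2 * Real.pi) (by
          rw [show s' - (u' + 2 * Real.pi) = s' - u' - 2 * Real.pi by ring]; exact h1.le)
        rw [(hper t) u', hsu', sub_self, norm_zero] at h2
        have h3 : |s' - (u' + 2 * Real.pi)| = 0 := by nlinarith [abs_nonneg (s' - (u' + 2 * Real.pi))]
        rw [abs_eq_zero, sub_eq_zero] at h3
        refine ⟨l - k - 1, ?_⟩
        rw [hs'_def, hu'_def] at h3
        push_cast; linarith
      · have h2 := ht_loc s' (u' - 2 * Real.pi) (by
          rw [show s' - (u' - 2 * Real.pi) = s' - u' + 2 * Real.pi by ring]; exact h1.le)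
        rw [(hper t).sub_eq u', hsu', sub_self, norm_zero] at h2
        have h3 : |s' - (u' - 2 * Real.pi)| = 0 := by nlinarith [abs_nonneg (s' - (u' - 2 * Real.pi))]
        rw [abs_eq_zero, sub_eq_zero] at h3
        refine ⟨l - k + 1, ?_⟩
        rw [hs'_def, hu'_def] at h3
        push_cast; linarith
    · -- near a crossing pair: it is the tracked crossing
      right; left
      simp only [hN₂_def, mem_iUnion, mem_union, mem_setOf_eq] at hp2
      obtain ⟨i, hbox⟩ := hp2
      refine ⟨i, -k, -l, ?_⟩
      have e1 : s + ((-k : ℤ) : ℝ) * (2 * Real.pi) = s' := by rw [hs'_def]; push_cast; ring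
      have e2 : u + ((-l : ℤ) : ℝ) * (2 * Real.pi) = u' := by rw [hu'_def]; push_cast; ring
      rw [e1, e2]
      simp only [hΘ_def, GaussDiagram.trackθ_overPos, GaussDiagram.trackθ_underPos]
      rcases hbox with ⟨h1, h2⟩ | ⟨h1, h2⟩
      · obtain ⟨hs1, hu1⟩ := huniq i t s' u' (ht_time i) h1 h2 hsu'
        rw [hs1, hu1]
      · obtain ⟨hu1, hs1⟩ := huniq i t u' s' (ht_time i) h2 h1 hsu'.symm
        rw [hs1, hu1, Set.pair_comm]
    · -- both reduced parameters in the window: so are `s` and `u`, by periodicity of `W`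
      right; right
      simp only [hN₃_def, mem_setOf_eq] at hp3
      have e1 : s' + k * (2 * Real.pi) = s := by rw [hs'_def]; ring
      have e2 : u' + l * (2 * Real.pi) = u := by rw [hu'_def]; ring
      refine ⟨?_, ?_⟩
      · rw [← e1]; exact (hWk s' k).2 hp3.1
      · rw [← e2]; exact (hWk u' l).2 hp3.2
  · -- heights
    simp only [hΘ_def, GaussDiagram.trackθ_overPos, GaussDiagram.trackθ_underPos]
    exact ht_height i
  · -- signs
    simp only [hΘ_def, GaussDiagram.trackθ_overPos, GaussDiagram.trackθ_underPos]
    rw [Matrix.det_fin_two_of, hDeq, hDeq, ht_sign i, h₀.sign_eq i, Matrix.det_fin_two_of, hDeq,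
      hDeq]

end IsRegularReadingOff

end Literature.Topology.FourManifolds
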